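import Literature.Computability.Cryptography.QubitRegister
import HarnessLib

/-!
# The `π/8` gate `T` is unitary — discharge of `tGate_mem_unitaryGroup`

Proof of the named fact `Literature.Computability.Cryptography.tGate_mem_unitaryGroup` stated in
`Literature.Computability.Cryptography.QubitRegister`. It is kept in its own sibling file: the
shared `QubitRegisterProofs.lean` is appended to concurrently by the discharges of the other
named-gate facts, and one file per discharge cannot be lost to a whole-file overwrite.

Mathematical content: `T = diag(1, e^{iπ/4})` (Nielsen–Chuang, §4.2, eq. (4.2), book p. 174) is a
diagonal matrix with unimodular diagonal entries, so `T T† = diag(1 · 1, e^{iπ/4} · e^{-iπ/4}) = 1`.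
Nielsen–Chuang introduce `T` among the single-qubit gates right after noting that "operations on
a qubit must preserve this norm, and thus are described by `2×2` unitary matrices" (§4.2, p. 174).
The proof below is self-contained (its two auxiliary steps — a diagonal matrix with entries `d i`
satisfying `d i · star (d i) = 1` is unitary; `e^{iθ} · conj e^{iθ} = 1` — are local `have`s), so
the file adds exactly one declaration.

## References

* M. A. Nielsen, I. L. Chuang, *Quantum Computation and Quantum Information*, 10th anniversary
  ed., Cambridge University Press 2010, doi:10.1017/cbo9780511976667, §4.2, eq. (4.2), p. 174
  (the single-qubit gates `H`, `S`, `T`). [cite: NielsenChuang2010, §4.2 eq. (4.2), p. 174]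
-/

namespace Literature.Computability.Cryptography

open Matrix

/-- **Discharge of `tGate_mem_unitaryGroup`.** The `π/8` gate `T = diag(1, e^{iπ/4})`
(Nielsen–Chuang, §4.2, eq. (4.2), p. 174) is unitary: `tGate` is the diagonal matrix on `QReg 1`
with entry `e^{iπ/4}` at the label with bit `true` and `1` at the label with bit `false`; each
diagonal entry `d` satisfies `d · conj d = 1` (for a phase, `e^{iθ} · conj e^{iθ} = e^{iθ + conj(iθ)}
= e^{2 Re(iθ)} = e^0 = 1`), hence `T T† = diag(d · conj d) = 1`, i.e. `T ∈ U(QReg 1)`.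
[cite: NielsenChuang2010, §4.2 eq. (4.2), p. 174] -/
theorem tGate_mem_unitaryGroup_holds : tGate_mem_unitaryGroup := by
  -- (1) a diagonal matrix whose entries satisfy `d i * star (d i) = 1` is unitary:
  --     `diag d * (diag d)ᴴ = diag (fun i => d i * star (d i)) = diag 1 = 1`.
  have hdiag : ∀ {d : QReg 1 → ℂ}, (∀ i, d i * star (d i) = 1) →
      Matrix.diagonal d ∈ Matrix.unitaryGroup (QReg 1) ℂ := by
    intro d hd
    rw [Matrix.mem_unitaryGroup_iff, star_eq_conjTranspose, diagonal_conjTranspose,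
      diagonal_mul_diagonal, ← diagonal_one]
    congr 1
    funext i
    exact hd i
  -- (2) a phase times its conjugate is `1`: `e^{iθ} · conj e^{iθ} = e^{iθ + conj (iθ)} = e^{2 re (iθ)} = 1`.
  have hphase : ∀ θ : ℝ,
      Complex.exp (θ * Complex.I) * star (Complex.exp (θ * Complex.I)) = 1 := by
    intro θ
    rw [Complex.star_def, ← Complex.exp_conj, ← Complex.exp_add, Complex.add_conj]
    simp
  -- (3) `T = diag(1, e^{iπ/4})`: definitional unfolding of `tGate` (NC eq. (4.2)).
  have hT : tGate = Matrix.diagonal fun x : QReg 1 =>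
      if x 0 = true then Complex.exp (Real.pi / 4 * Complex.I) else 1 := by
    ext x y
    rw [tGate, Matrix.of_apply, Matrix.diagonal_apply]
  unfold tGate_mem_unitaryGroup
  rw [hT]
  refine hdiag fun x => ?_
  split_ifs
  · simpa [Complex.ofReal_div] using hphase (Real.pi / 4)
  · simp

end Literature.Computability.Cryptography
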